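import Mathlib
import Literature.Computability.AlgebraicComplexity.ArithCircuit
import Literature.Computability.AlgebraicComplexity.StandardFamilies
import Summits.ValiantsHypothesis.ValiantsHypothesis.Theses.DivisionGap

/-!
# Sketch (ideator 3, crux PerDivisionHard = stmt-ValiantsHypothesis-5065, round 1)

First lemmas of the two idea cards, stated as `Prop`s over existing declarations so that the
file elaborates sorry-free.  `L` below is the tree's `complexity` over the semiring `ℝ≥0`
(monotone fan-in-two circuits with positive weights), `per` is `perPoly (Fin n) ℝ≥0`.

Card `newton-fan-descent`  : LeadingFormClosure, LeadingForm_mul, MonomialContraction,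
                             FaceOfPer, RigidHardFace (load-bearing).
Card `two-level-clean-rows` : TwoLevelDecomposition, ColumnConfinement, PairEmbeddingCount,
                             LowDegreeMultiplesHard (rung B1), PerSquaredHard (rung B2).
-/

namespace Summit.ValiantsHypothesis.ValiantsHypothesis.Cruxes.PerDivisionHard.Ideator3

open MvPolynomial Literature.Computability.AlgebraicComplexity
open scoped NNReal BigOperators

noncomputable section

/-- The leading form (top face) of `f` in the direction of the nonnegative integer weight `w`:
the weighted-homogeneous component of maximal `w`-degree.  Over `ℝ≥0` this is the initial form
`in_w`; faces of the Birkhoff polytope are reached with `w = 𝟙_G`. -/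
def leadingForm {σ : Type} (w : σ → ℕ) (f : MvPolynomial σ ℝ≥0) : MvPolynomial σ ℝ≥0 :=
  weightedHomogeneousComponent w (weightedTotalDegree w f) f

/-! ### Card A — newton-fan-descent -/

/-- **S1 (LeadingFormClosure).** Passing to a leading form never increases monotone complexity:
replace every sum gate `c•u + d•v` of a minimal circuit by the leading-form selection
(`c• lf u`, `d • lf v`, or both when the `w`-degrees tie) and keep product gates; over `ℝ≥0`
no leading monomial cancels, so the new circuit computes `leadingForm w f` exactly. -/
def LeadingFormClosure : Prop :=
  ∀ (σ : Type) [Fintype σ] [DecidableEq σ] (w : σ → ℕ) (f : MvPolynomial σ ℝ≥0),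
    complexity (leadingForm w f) ≤ complexity f

/-- **S1' (multiplicativity).** Over `ℝ≥0` (no zero divisors, no cancellation) leading forms are
multiplicative; in particular `leadingForm w (per * h) = leadingForm w per * leadingForm w h`. -/
def LeadingForm_mul : Prop :=
  ∀ (σ : Type) [Fintype σ] [DecidableEq σ] (w : σ → ℕ) (f g : MvPolynomial σ ℝ≥0),
    leadingForm w (f * g) = leadingForm w f * leadingForm w g

/-- **S3 (MonomialContraction; Jukna–Seiwert–Sergeev, arithmetic form of Jukna 2023 Thm 6.11 /
Rem 6.19).** Dividing out a monomial factor costs at most quadratically: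
`L(f) ≤ K · (#vars + 1)³ · (L(xᵉ·f) + 1)²`. -/
def MonomialContraction : Prop :=
  ∃ K : ℕ, ∀ (σ : Type) [Fintype σ] [DecidableEq σ] (e : σ →₀ ℕ) (f : MvPolynomial σ ℝ≥0),
    complexity f ≤ K * (Fintype.card σ + 1) ^ 3 * (complexity (monomial e 1 * f) + 1) ^ 2

/-- **FaceOfPer.** For an edge set `G ⊆ Fin n × Fin n` containing a perfect matching, the leading
form of `per` in direction `𝟙_G` is the perfect-matching polynomial of `G`
(a face of the Birkhoff polytope). -/
def FaceOfPer : Prop :=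
  ∀ (n : ℕ) (G : Finset (Fin n × Fin n)), (∃ ρ : Equiv.Perm (Fin n), ∀ i, (ρ i, i) ∈ G) →
    leadingForm (fun ij => if ij ∈ G then 1 else 0) (perPoly (Fin n) ℝ≥0) =
      ∑ ρ ∈ (Finset.univ : Finset (Equiv.Perm (Fin n))).filter (fun ρ => ∀ i, (ρ i, i) ∈ G),
        ∏ i : Fin n, X (ρ i, i)

/-- Row-and-column bihomogeneity of `h` (all monomials have the same row-sum and column-sum
vectors); WLOG for the crux by S1 applied with the `2n - 1` Birkhoff lineality weights. -/
def IsBihomogeneous {n : ℕ} (h : MvPolynomial (Fin n × Fin n) ℝ≥0) : Prop :=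
  ∃ (α β : Fin n → ℕ), ∀ m ∈ h.support, (∀ i, ∑ j, m (i, j) = α i) ∧ (∀ j, ∑ i, m (i, j) = β j)

/-- **S5 (RigidHardFace) — the load-bearing lemma of card A.** Every quasi-polynomially cheap,
nonzero, bihomogeneous `h` admits a direction `w` (a relabelled high-girth hard face of the
Birkhoff polytope approached with generic slacks) in which `h` is *rigid* — its leading form is a
single monomial — while the corresponding face polynomial of `per` is still hard enough to absorb
the quadratic contraction loss.  No `per · h` appears: this is a statement about `h` alone plus
known-type monotone lower bounds for sparse perfect-matching polynomials. -/
def RigidHardFace : Prop :=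
  ∀ c : ℕ, ∃ n₀ : ℕ, ∀ n ≥ n₀, ∀ h : MvPolynomial (Fin n × Fin n) ℝ≥0, h ≠ 0 →
    IsBihomogeneous h → complexity h ≤ 2 ^ ((Nat.log 2 n + c) ^ c) →
    ∃ w : Fin n × Fin n → ℕ,
      (leadingForm w h).support.card = 1 ∧
      ∀ K : ℕ, K ≤ 2 ^ ((Nat.log 2 n + c) ^ c) →
        K * (n ^ 2 + 1) * (2 ^ ((Nat.log 2 n + c) ^ c) + 1) ^ 2 <
          complexity (leadingForm w (perPoly (Fin n) ℝ≥0))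

/-- **Bihomogenisation is free (S2).** From any nonzero `h` one reaches a nonzero bihomogeneous
`h'` (an iterated lineality-direction leading form) without increasing either complexity. -/
def FreeBihomogenisation : Prop :=
  ∀ (n : ℕ) (h : MvPolynomial (Fin n × Fin n) ℝ≥0), h ≠ 0 →
    ∃ h' : MvPolynomial (Fin n × Fin n) ℝ≥0, h' ≠ 0 ∧ IsBihomogeneous h' ∧
      complexity (perPoly (Fin n) ℝ≥0 * h') ≤ complexity (perPoly (Fin n) ℝ≥0 * h) ∧
      complexity h' ≤ complexity h

/-! ### Card B — two-level-clean-rows -/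

/-- **TwoLevelDecomposition.** Iterating the tree's one-level structure theorem
(`Literature.Barriers.ValiantsHypothesis.exists_decomposition`) once inside each product gate:
a fan-in-two circuit over `ℝ≥0` with `s` gates computing a homogeneous `F` of degree `D` writes
`F` as at most `s²` products `a · b · c ≤ F` with `m₂ < deg a ≤ 2 m₂` and
`m₁ < deg a + deg b ≤ 2 m₁`, for any thresholds `1 ≤ m₂`, `2 m₂ < m₁`, `2 m₁ < D`…
(stated loosely: thresholds as hypotheses). -/
def TwoLevelDecomposition : Prop :=
  ∀ (σ : Type) [Fintype σ] [DecidableEq σ] (F : MvPolynomial σ ℝ≥0) (D m₁ m₂ : ℕ),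
    F.IsHomogeneous D → 1 ≤ m₂ → 2 * m₂ ≤ m₁ → m₁ < D →
    ∀ P : ArithCircuit ℝ≥0 σ, P.IsFanInTwo → P.Computes F →
    ∃ (J : Finset (ℕ × ℕ)) (a b c : ℕ × ℕ → MvPolynomial σ ℝ≥0),
      J.card ≤ P.size ^ 2 ∧ F = ∑ j ∈ J, a j * b j * c j ∧
      ∀ j ∈ J, m₂ < (a j).totalDegree ∧ (a j).totalDegree ≤ 2 * m₂ ∧
        m₁ < (a j * b j).totalDegree ∧ (a j * b j).totalDegree ≤ 2 * m₁

/-- **ColumnConfinement (the clean-row lemma).** A uniformly random permutation maps a fixed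
row set `I` into a fixed column set `J` with probability `C(|J|,|I|)/C(n,|I|)`:
`#{σ : σ(I) ⊆ J} · C(n,|I|) = n! · C(|J|,|I|)`. -/
def ColumnConfinement : Prop :=
  ∀ (n : ℕ) (I J : Finset (Fin n)),
    ((Finset.univ : Finset (Equiv.Perm (Fin n))).filter (fun σ => ∀ i ∈ I, σ i ∈ J)).card
        * Nat.choose n I.card = Nat.factorial n * Nat.choose J.card I.card

/-- **PairEmbeddingCount (for the powers rung).** A fixed permutation `ρ` embeds row-wise into
`P_σ + P_τ` for at most `(n+1)·n!` of the `n!²` pairs `(σ, τ)`. -/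
def PairEmbeddingCount : Prop :=
  ∀ (n : ℕ) (ρ : Equiv.Perm (Fin n)),
    ((Finset.univ : Finset (Equiv.Perm (Fin n) × Equiv.Perm (Fin n))).filter
        (fun p => ∀ i, ρ i = p.1 i ∨ ρ i = p.2 i)).card ≤ (n + 1) * Nat.factorial n

/-- **Rung B1 (LowDegreeMultiplesHard).** Every nonzero monotone multiple `per · h` with
`deg h ≤ n/10` needs monotone circuits of size `2^{Ω(n)}` (one/two-level structure theorem +
bigrading + ColumnConfinement on the clean rows).  New: previously only `h` a monomial. -/
def LowDegreeMultiplesHard : Prop :=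
  ∃ K n₀ : ℕ, ∀ n ≥ n₀, ∀ h : MvPolynomial (Fin n × Fin n) ℝ≥0, h ≠ 0 → h.totalDegree ≤ n / 10 →
    2 ^ (n / K) < complexity (perPoly (Fin n) ℝ≥0 * h)

/-- **Rung B2 (PerSquaredHard)**, the first power beyond Boolean transfer: `L(per²) ≥ 2^{Ω(n)}`
(two-level structure theorem + PairEmbeddingCount / run-component counting). -/
def PerSquaredHard : Prop :=
  ∃ K n₀ : ℕ, ∀ n ≥ n₀, 2 ^ (n / K) < complexity ((perPoly (Fin n) ℝ≥0) ^ 2)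

/-- **B2' (PowersRung, conjectural range).** `L(per^m) ≥ 2^{n/(K m³)}` — super-quasi-polynomial
for `m ≤ n^{1/3-δ}`; the card argues for `2^{n/(K m² log m)}`. -/
def PowersRung : Prop :=
  ∃ K n₀ : ℕ, ∀ n ≥ n₀, ∀ m : ℕ, 1 ≤ m →
    2 ^ (n / (K * m ^ 3)) < complexity ((perPoly (Fin n) ℝ≥0) ^ m)

end

end Summit.ValiantsHypothesis.ValiantsHypothesis.Cruxes.PerDivisionHard.Ideator3
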